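import Mathlib.Analysis.SpecialFunctions.Exponential
import Literature.MathematicalPhysics.QuantumLattice.KomaTasakiTower

/-!
# Koma–Tasaki 1994, Theorem 2.4: the `π`-rotation `U = exp[i (π/√γ) O⁽¹⁾]` (hypothesis vi))

Towards the proof of the named fact `theorem_2_4` of `KomaTasakiSSB.lean` (T. Koma, H. Tasaki,
*Symmetry breaking and finite-size effects in quantum many-body systems*, J. Stat. Phys. **76**
(1994) 745–803, `KomaTasaki1994`, Theorem 2.4 and Section 5).

Hypothesis vi) of Theorem 2.4 is `U H U⁻¹ = H`, `U Φ ∝ Φ` for `U = exp[i (π/√γ) O⁽¹⁾]`. Section 5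
of the paper uses it only through the algebraic consequences
`U O^± U⁻¹ = O^∓` (KT write `-O^{-σ}`; the sign is immaterial), `U C U⁻¹ = -C`, hence `C Φ = 0`
and the reflection identity `⟨Φ, O^{-M} X O^{+M} Φ⟩ = ⟨Φ, O^{+M} X O^{-M} Φ⟩` for `U X = X U`
(KT p. 785, "by using the relation `U O^σ U⁻¹ = -O^{-σ}` (which follows from (2.23)) … implies that
`C Φ = 0`"). This file derives exactly these consequences from v) `[O⁽¹⁾, O⁽²⁾] = iγ C` and
(2.14), with Mathlib's `NormedSpace.exp`:

* the ladder trick: `P± := O⁽²⁾ ± i√γ C` satisfy `[X, P±] = ± iπ P±` for `X = i(π/√γ) O⁽¹⁾`, so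
  `e^X P± = P± e^{X ± iπ} = -P± e^X` (`SemiconjBy.exp_right`), giving `U O⁽²⁾ = -O⁽²⁾ U`,
  `U C = -C U`, `U O⁽¹⁾ = O⁽¹⁾ U` (`rotation_mul_order_one`, `rotation_mul_C`, …);
* unitarity `U† U = 1` (`iθ O⁽¹⁾` is skew-adjoint; `NormedSpace.exp_mem_unitary_of_mem_skewAdjoint`);
* `C Φ = 0` and the reflection identity for expectation values in a `U`-eigenvector `Φ`.

No new hypotheses are introduced; everything is a theorem about `U1System` (`U1System.rotation`
is defined in `KomaTasakiTower`).

Locators: equation labels such as `(bmDef)`, `(K+Lcond)`, `(dBound1)`, `(OBO2)`, `(Bunshi)` and the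
lemma names `easyLemma`/`hardLemma`/`subLemma` (the three lemmas of §5, in this order) are those
of the arXiv source cond-mat/9708132 of `KomaTasaki1994`.

Consumers (2026-08-29): `AndersonTowerOfStates.lean` re-derives hypothesis vi) for quantum spins by the same
ladder device (`XXZKT.rotation_one_mul_siteSpin`), and `AndersonTowerOfStatesUnconditional.lean` imports the chain
`KomaTasakiTowerExp → … → KomaTasakiSSBTowerProofs` to apply Theorem 2.4 (`theorem_2_4_holds`) to the Heisenberg
antiferromagnet and hard-core bosons (KT94 Corollary 2.11, §3.2–§3.3).
-/

noncomputable section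

open Complex Finset
open scoped InnerProductSpace ComplexConjugate

namespace Literature.MathematicalPhysics.QuantumLattice.KomaTasaki

universe u v

variable {Λ : Type u} [Fintype Λ] {E : Type v} [NormedAddCommGroup E] [InnerProductSpace ℂ E]

/-! ### Two general facts about `NormedSpace.exp` on `E →L[ℂ] E` -/

section General

variable [CompleteSpace E]

/-- **Ladder relation for the exponential.** If `[X, P] = c P` then `P e^{X + c} = e^X P`, hence
`e^X P = e^{c} P e^X`; here in the form `X P - P X = c • P ⟹ exp X * P = exp c • (P * exp X)`.
[folklore] -/
theorem exp_mul_eq_smul_mul_exp_of_comm_eq_smul (X P : E →L[ℂ] E) (c : ℂ)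
    (h : X * P - P * X = c • P) :
    NormedSpace.exp X * P = Complex.exp c • (P * NormedSpace.exp X) := by
  letI : NormedAlgebra ℚ (E →L[ℂ] E) := .restrictScalars ℚ ℂ _
  have hs : SemiconjBy P (X + c • (1 : E →L[ℂ] E)) X := by
    rw [SemiconjBy, mul_add, mul_smul_comm, mul_one]
    rw [sub_eq_iff_eq_add] at h
    rw [h]; abel
  have h1 : NormedSpace.exp (c • (1 : E →L[ℂ] E)) = Complex.exp c • (1 : E →L[ℂ] E) := by
    have h2 : c • (1 : E →L[ℂ] E) = algebraMap ℂ (E →L[ℂ] E) c :=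
      (Algebra.algebraMap_eq_smul_one c).symm
    rw [h2, ← NormedSpace.algebraMap_exp_comm, Algebra.algebraMap_eq_smul_one,
      Complex.exp_eq_exp_ℂ]
  have h3 : NormedSpace.exp (X + c • (1 : E →L[ℂ] E)) =
      NormedSpace.exp X * NormedSpace.exp (c • (1 : E →L[ℂ] E)) :=
    NormedSpace.exp_add_of_commute ((Commute.one_right X).smul_right c)
  have h4 := hs.exp_right.eq
  rw [h3, h1, mul_smul_comm, mul_one, mul_smul_comm] at h4
  exact h4.symm

/-- `exp (i t X)` is unitary for symmetric `X` and real `t`: `(e^{itX})† e^{itX} = 1`.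
[folklore] -/
theorem star_exp_mul_exp_of_isSymmetric (X : E →L[ℂ] E) (hX : (X : E →ₗ[ℂ] E).IsSymmetric)
    (t : ℝ) :
    star (NormedSpace.exp ((I * t) • X)) * NormedSpace.exp ((I * t) • X) = 1 := by
  letI : NormedAlgebra ℚ (E →L[ℂ] E) := .restrictScalars ℚ ℂ _
  have hsa : IsSelfAdjoint X := by
    rw [ContinuousLinearMap.isSelfAdjoint_iff_isSymmetric]; exact hX
  have hmem : (I * t) • X ∈ skewAdjoint (E →L[ℂ] E) := by
    rw [skewAdjoint.mem_iff, star_smul, hsa.star_eq, ← neg_smul]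
    congr 1
    simp [conj_ofReal]
  exact Unitary.star_mul_self_of_mem (NormedSpace.exp_mem_unitary_of_mem_skewAdjoint hmem)

/-- A unitary preserves inner products. [folklore] -/
theorem inner_map_map_of_star_mul_self (U : E →L[ℂ] E) (hU : star U * U = 1) (x y : E) :
    ⟪U x, U y⟫_ℂ = ⟪x, y⟫_ℂ := by
  rw [← ContinuousLinearMap.adjoint_inner_right, ← mul_apply_eq_comp,
    ← ContinuousLinearMap.star_eq_adjoint, hU, one_apply_eq_self]

/-- If `U† U = 1`, `U Φ = c Φ` and `Φ ≠ 0` then `|c| = 1`. [folklore] -/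
theorem norm_eq_one_of_eigen_of_star_mul_self (U : E →L[ℂ] E) (hU : star U * U = 1) {Φ : E}
    {c : ℂ} (hΦ : Φ ≠ 0) (hc : U Φ = c • Φ) : ‖c‖ = 1 := by
  have h1 : ⟪U Φ, U Φ⟫_ℂ = ⟪Φ, Φ⟫_ℂ := inner_map_map_of_star_mul_self U hU Φ Φ
  rw [hc, inner_smul_left, inner_smul_right, ← mul_assoc] at h1
  have h2 : conj c * c = 1 := mul_left_injective₀ (inner_self_ne_zero.mpr hΦ) (by simpa using h1)
  have h3 : ‖c‖ * ‖c‖ = 1 := by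
    have := congrArg norm h2
    rwa [norm_mul, RCLike.norm_conj, norm_one] at this
  have h4 : ‖c‖ ^ 2 = 1 := by rw [sq]; exact h3
  exact (pow_eq_one_iff_of_nonneg (norm_nonneg c) two_ne_zero).mp h4

/-- **Reflection identity.** If `U† U = 1`, `U Φ = c Φ`, `Φ ≠ 0` and `U W = W' U`, then
`⟨Φ, W Φ⟩ = ⟨Φ, W' Φ⟩`. [folklore] -/
theorem inner_eq_inner_of_semiconj (U W W' : E →L[ℂ] E) (hU : star U * U = 1) {Φ : E} {c : ℂ}
    (hΦ : Φ ≠ 0) (hc : U Φ = c • Φ) (hW : U * W = W' * U) :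
    ⟪Φ, W Φ⟫_ℂ = ⟪Φ, W' Φ⟫_ℂ := by
  have hnc : ‖c‖ = 1 := norm_eq_one_of_eigen_of_star_mul_self U hU hΦ hc
  have hc0 : c ≠ 0 := by
    intro h0; rw [h0, norm_zero] at hnc; exact zero_ne_one hnc
  -- `U† Φ = c⁻¹ Φ`
  have hstar : (star U) Φ = c⁻¹ • Φ := by
    have h1 : (star U * U) Φ = Φ := by rw [hU, one_apply_eq_self]
    rw [mul_apply_eq_comp, hc, map_smul] at h1
    calc (star U) Φ = c⁻¹ • (c • (star U) Φ) := by rw [smul_smul, inv_mul_cancel₀ hc0, one_smul]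
      _ = c⁻¹ • Φ := by rw [h1]
  -- `conj c⁻¹ = c`
  have hconj : conj c⁻¹ = c := by
    rw [RCLike.inv_eq_conj hnc]
    exact RCLike.conj_conj c
  have h2 : ⟪Φ, W' Φ⟫_ℂ * c = c * ⟪Φ, W Φ⟫_ℂ := by
    calc ⟪Φ, W' Φ⟫_ℂ * c = ⟪Φ, W' (U Φ)⟫_ℂ := by rw [hc, map_smul, inner_smul_right, mul_comm]
      _ = ⟪Φ, U (W Φ)⟫_ℂ := by rw [← mul_apply_eq_comp, ← hW, mul_apply_eq_comp]
      _ = ⟪(star U) Φ, W Φ⟫_ℂ := by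
          rw [ContinuousLinearMap.star_eq_adjoint, ContinuousLinearMap.adjoint_inner_left]
      _ = c * ⟪Φ, W Φ⟫_ℂ := by rw [hstar, inner_smul_left, hconj]
  have h3 := mul_right_cancel₀ hc0 (h2.trans (mul_comm _ _))
  exact h3.symm

end General

/-! ### The rotation `U = exp[i (π/√γ) O⁽¹⁾]` of a `U1System` -/

namespace U1System

variable (sys : U1System Λ E)

/-- (2.14), first relation, for `order`: `O⁽¹⁾ C - C O⁽¹⁾ = -i O⁽²⁾`. [cite: KomaTasaki1994, (2.14)] -/
theorem order_zero_mul_C_sub : sys.order 0 * sys.C - sys.C * sys.order 0 = -(I • sys.order 1) :=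
  sys.order_zero_C

/-- (2.14), second relation, for `order`: `O⁽²⁾ C - C O⁽²⁾ = i O⁽¹⁾`. [cite: KomaTasaki1994, (2.14)] -/
theorem order_one_mul_C_sub : sys.order 1 * sys.C - sys.C * sys.order 1 = I • sys.order 0 :=
  sys.order_one_C

variable {sys}

/-- The ladder operators `P± = O⁽²⁾ ± i√γ C` for `ad_{O⁽¹⁾}`: under v) `[O⁽¹⁾, O⁽²⁾] = iγ C` and
(2.14), `[X, P±] = ± iπ P±` with `X = i (π/√γ) O⁽¹⁾` (`γ > 0`). [cite: KomaTasaki1994, §5 proof of Theorem 2.4] -/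
theorem rotation_generator_ladder {γ : ℝ} (hγ : 0 < γ)
    (hv : sys.order 0 * sys.order 1 - sys.order 1 * sys.order 0 = (I * γ) • sys.C) (ε : ℝ)
    (hε : ε = 1 ∨ ε = -1) :
    ((I * ↑(Real.pi / Real.sqrt γ)) • sys.order 0) * (sys.order 1 + (ε * (I * Real.sqrt γ)) • sys.C) -
      (sys.order 1 + (ε * (I * Real.sqrt γ)) • sys.C) * ((I * ↑(Real.pi / Real.sqrt γ)) • sys.order 0) =
      (ε * (Real.pi * I)) • (sys.order 1 + (ε * (I * Real.sqrt γ)) • sys.C) := by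
  have hC : sys.order 0 * sys.C - sys.C * sys.order 0 = -(I • sys.order 1) := sys.order_zero_C
  have hsq : (Real.sqrt γ : ℂ) * Real.sqrt γ = γ := by
    rw [← Complex.ofReal_mul, Real.mul_self_sqrt hγ.le]
  have hsq0 : (Real.sqrt γ : ℂ) ≠ 0 := by
    exact_mod_cast (Real.sqrt_pos.mpr hγ).ne'
  have hε2 : (ε : ℂ) * ε = 1 := by
    rcases hε with h | h <;> simp [h]
  set θ : ℂ := (↑(Real.pi / Real.sqrt γ) : ℂ) with hθ
  have hθ' : θ * Real.sqrt γ = Real.pi := by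
    rw [hθ, Complex.ofReal_div, div_mul_cancel₀ _ hsq0]
  -- expand both sides in terms of the two commutators
  have e1 : ((I * θ) • sys.order 0) * (sys.order 1 + (ε * (I * Real.sqrt γ)) • sys.C) -
      (sys.order 1 + (ε * (I * Real.sqrt γ)) • sys.C) * ((I * θ) • sys.order 0) =
      (I * θ) • (sys.order 0 * sys.order 1 - sys.order 1 * sys.order 0) +
        (I * θ * (ε * (I * Real.sqrt γ))) • (sys.order 0 * sys.C - sys.C * sys.order 0) := by
    simp only [smul_mul_assoc, mul_smul_comm, mul_add, add_mul, smul_sub, smul_add, ← mul_smul]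
    rw [mul_comm (ε * (I * ↑(Real.sqrt γ))) (I * θ)]
    abel
  rw [e1, hv, hC, smul_neg, ← mul_smul, ← mul_smul, smul_add, ← mul_smul]
  -- compare coefficients
  have c1 : I * θ * (I * ↑γ) = ε * (↑Real.pi * I) * (ε * (I * ↑(Real.sqrt γ))) := by
    have : I * θ * (I * ↑γ) = I * I * (θ * Real.sqrt γ) * Real.sqrt γ := by
      rw [← hsq]; ring
    rw [this, hθ']
    linear_combination (-(I * I * ↑Real.pi * ↑(Real.sqrt γ))) * hε2
  have c2 : -(I * θ * (ε * (I * ↑(Real.sqrt γ))) * I) = ε * (↑Real.pi * I) := by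
    have : I * θ * (ε * (I * ↑(Real.sqrt γ))) * I = I * I * I * ε * (θ * Real.sqrt γ) := by ring
    rw [this, hθ', I_mul_I]
    ring
  rw [← neg_smul, c1, c2, add_comm]

/-- `U O⁽²⁾ = -O⁽²⁾ U` and `U C = -C U` for the `π`-rotation `U` (from v), (2.14), `γ > 0`).
[cite: KomaTasaki1994, §5 proof of Theorem 2.4] -/
theorem rotation_mul_order_one_and_C [CompleteSpace E] {γ : ℝ} (hγ : 0 < γ)
    (hv : sys.order 0 * sys.order 1 - sys.order 1 * sys.order 0 = (I * γ) • sys.C) :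
    sys.rotation γ * sys.order 1 = -(sys.order 1 * sys.rotation γ) ∧
      sys.rotation γ * sys.C = -(sys.C * sys.rotation γ) := by
  set X : E →L[ℂ] E := (I * ↑(Real.pi / Real.sqrt γ)) • sys.order 0 with hX
  set Pp : E →L[ℂ] E := sys.order 1 + ((1 : ℝ) * (I * Real.sqrt γ)) • sys.C with hPp
  set Pm : E →L[ℂ] E := sys.order 1 + ((-1 : ℝ) * (I * Real.sqrt γ)) • sys.C with hPm
  have hp := rotation_generator_ladder hγ hv 1 (Or.inl rfl)
  have hm := rotation_generator_ladder hγ hv (-1) (Or.inr rfl)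
  have ep := exp_mul_eq_smul_mul_exp_of_comm_eq_smul X Pp _ hp
  have em := exp_mul_eq_smul_mul_exp_of_comm_eq_smul X Pm _ hm
  have h1 : Complex.exp ((1 : ℝ) * (Real.pi * I)) = -1 := by
    push_cast; rw [one_mul, Complex.exp_pi_mul_I]
  have h2 : Complex.exp ((-1 : ℝ) * (Real.pi * I)) = -1 := by
    push_cast
    rw [neg_one_mul, Complex.exp_neg, Complex.exp_pi_mul_I]; norm_num
  rw [h1, neg_one_smul] at ep
  rw [h2, neg_one_smul] at em
  have hU : sys.rotation γ = NormedSpace.exp X := rfl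
  have hsq0 : (Real.sqrt γ : ℂ) ≠ 0 := by exact_mod_cast (Real.sqrt_pos.mpr hγ).ne'
  -- `2 O⁽²⁾ = P₊ + P₋`, `2 i √γ C = P₊ - P₋`
  have hO : Pp + Pm = (2 : ℂ) • sys.order 1 := by
    simp only [hPp, hPm]; push_cast; module
  have hCc : Pp - Pm = (2 * (I * Real.sqrt γ)) • sys.C := by
    simp only [hPp, hPm]; push_cast; module
  constructor
  · have hadd : NormedSpace.exp X * (Pp + Pm) = -((Pp + Pm) * NormedSpace.exp X) := by
      rw [mul_add, add_mul, ep, em, neg_add]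
    rw [hO, mul_smul_comm, smul_mul_assoc, ← smul_neg] at hadd
    rw [hU]
    exact smul_right_injective (E →L[ℂ] E) (two_ne_zero) hadd
  · have hk : (2 * (I * (Real.sqrt γ : ℂ))) ≠ 0 :=
      mul_ne_zero two_ne_zero (mul_ne_zero I_ne_zero hsq0)
    have hsub : NormedSpace.exp X * (Pp - Pm) = -((Pp - Pm) * NormedSpace.exp X) := by
      rw [mul_sub, sub_mul, ep, em, neg_sub_neg, neg_sub]
    rw [hCc, mul_smul_comm, smul_mul_assoc, ← smul_neg] at hsub
    rw [hU]
    exact smul_right_injective (E →L[ℂ] E) hk hsub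

/-- `U O⁽¹⁾ = O⁽¹⁾ U`. [cite: KomaTasaki1994, §5 proof of Theorem 2.4] -/
theorem rotation_mul_order_zero [CompleteSpace E] (γ : ℝ) :
    sys.rotation γ * sys.order 0 = sys.order 0 * sys.rotation γ := by
  unfold rotation
  exact (((Commute.refl (sys.order 0)).smul_left (I * ↑(Real.pi / Real.sqrt γ))).exp_left).eq

/-- `U O⁺ = O⁻ U` for the `π`-rotation `U` (KT: `U O^σ U⁻¹ = ∓O^{-σ}`; with the conventions of
(2.14), (2.23) the sign is `+`). [cite: KomaTasaki1994, §5 proof of Theorem 2.4] -/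
theorem rotation_mul_orderPlus [CompleteSpace E] {γ : ℝ} (hγ : 0 < γ)
    (hv : sys.order 0 * sys.order 1 - sys.order 1 * sys.order 0 = (I * γ) • sys.C) :
    sys.rotation γ * sys.orderPlus = sys.orderMinus * sys.rotation γ := by
  have h1 := (rotation_mul_order_one_and_C hγ hv).1
  rw [orderPlus, orderMinus, mul_add, sub_mul, mul_smul_comm, h1, smul_neg, rotation_mul_order_zero,
    smul_mul_assoc, sub_eq_add_neg]

/-- `U O⁻ = O⁺ U` for the `π`-rotation `U`. [cite: KomaTasaki1994, §5 proof of Theorem 2.4] -/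
theorem rotation_mul_orderMinus [CompleteSpace E] {γ : ℝ} (hγ : 0 < γ)
    (hv : sys.order 0 * sys.order 1 - sys.order 1 * sys.order 0 = (I * γ) • sys.C) :
    sys.rotation γ * sys.orderMinus = sys.orderPlus * sys.rotation γ := by
  have h1 := (rotation_mul_order_one_and_C hγ hv).1
  rw [orderPlus, orderMinus, mul_sub, add_mul, mul_smul_comm, h1, smul_neg, rotation_mul_order_zero,
    smul_mul_assoc, sub_neg_eq_add]

/-- `U C = -C U` for the `π`-rotation `U`. [cite: KomaTasaki1994, §5 proof of Theorem 2.4] -/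
theorem rotation_mul_C [CompleteSpace E] {γ : ℝ} (hγ : 0 < γ)
    (hv : sys.order 0 * sys.order 1 - sys.order 1 * sys.order 0 = (I * γ) • sys.C) :
    sys.rotation γ * sys.C = -(sys.C * sys.rotation γ) :=
  (rotation_mul_order_one_and_C hγ hv).2

/-- `U` is unitary: `U† U = 1`. [cite: KomaTasaki1994, §2.3 vi)] -/
theorem star_rotation_mul_rotation [CompleteSpace E] (γ : ℝ) :
    star (sys.rotation γ) * sys.rotation γ = 1 :=
  star_exp_mul_exp_of_isSymmetric _ (sys.isSymmetric_order 0) _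

/-- **`C Φ = 0`** for a simultaneous eigenvector `Φ` of `C` and of the `π`-rotation `U`
(KT p. 785: "the symmetry vi), along with the relation `U C U⁻¹ = -C` … implies that `C Φ = 0`").
[cite: KomaTasaki1994, §5 proof of Theorem 2.4] -/
theorem C_apply_eq_zero_of_rotation [CompleteSpace E] {γ : ℝ} (hγ : 0 < γ)
    (hv : sys.order 0 * sys.order 1 - sys.order 1 * sys.order 0 = (I * γ) • sys.C) {Φ : E}
    (hΦ : Φ ≠ 0) {c c' : ℂ} (hc : sys.rotation γ Φ = c • Φ) (hc' : sys.C Φ = c' • Φ) :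
    sys.C Φ = 0 := by
  have hnc : ‖c‖ = 1 :=
    norm_eq_one_of_eigen_of_star_mul_self _ (sys.star_rotation_mul_rotation γ) hΦ hc
  have hc0 : c ≠ 0 := by
    intro h0; rw [h0, norm_zero] at hnc; exact zero_ne_one hnc
  have h1 : sys.rotation γ (sys.C Φ) = -(sys.C (sys.rotation γ Φ)) := by
    have := congrArg (fun T : E →L[ℂ] E => T Φ) (rotation_mul_C hγ hv)
    simpa [mul_apply_eq_comp] using this
  rw [hc', map_smul, hc, map_smul, hc', smul_smul, smul_smul, mul_comm c' c] at h1
  -- h1 : (c * c') • Φ = -((c * c') • Φ)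
  have h2 : ((c * c') + (c * c')) • Φ = 0 := by
    rw [add_smul]
    nth_rewrite 2 [h1]
    exact add_neg_cancel _
  rw [smul_eq_zero] at h2
  rcases h2 with h2 | h2
  · have : c * c' = 0 := by linear_combination h2 / 2
    rcases mul_eq_zero.mp this with h | h
    · exact absurd h hc0
    · rw [hc', h, zero_smul]
  · exact absurd h2 hΦ

/-- **Reflection identity** for the `π`-rotation: if `U Φ = c Φ`, `Φ ≠ 0`, and `U W = W' U`, then
`⟨Φ, W Φ⟩ = ⟨Φ, W' Φ⟩`; used with `W = (O⁻)^M X (O⁺)^M`, `W' = (O⁺)^M X (O⁻)^M`, `U X = X U`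
(KT §5: "we find that `Δ^{(M)}` can be written in terms of a double commutator").
[cite: KomaTasaki1994, §5 proof of Theorem 2.4] -/
theorem inner_eq_inner_of_rotation [CompleteSpace E] (γ : ℝ) {Φ : E} (hΦ : Φ ≠ 0) {c : ℂ}
    (hc : sys.rotation γ Φ = c • Φ) {W W' : E →L[ℂ] E}
    (hW : sys.rotation γ * W = W' * sys.rotation γ) : ⟪Φ, W Φ⟫_ℂ = ⟪Φ, W' Φ⟫_ℂ :=
  inner_eq_inner_of_semiconj _ W W' (sys.star_rotation_mul_rotation γ) hΦ hc hW

/-- `U (O⁻)^m X (O⁺)^n = (O⁺)^m X (O⁻)^n U` whenever `U X = X U`. [cite: KomaTasaki1994, §5 proof of Theorem 2.4] -/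
theorem rotation_mul_pow_mul_pow [CompleteSpace E] {γ : ℝ} (hγ : 0 < γ)
    (hv : sys.order 0 * sys.order 1 - sys.order 1 * sys.order 0 = (I * γ) • sys.C)
    {X : E →L[ℂ] E} (hX : sys.rotation γ * X = X * sys.rotation γ) (m n : ℕ) :
    sys.rotation γ * (sys.orderMinus ^ m * X * sys.orderPlus ^ n) =
      (sys.orderPlus ^ m * X * sys.orderMinus ^ n) * sys.rotation γ := by
  have hm : SemiconjBy (sys.rotation γ) (sys.orderMinus ^ m) (sys.orderPlus ^ m) :=
    SemiconjBy.pow_right (rotation_mul_orderMinus hγ hv) m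
  have hn : SemiconjBy (sys.rotation γ) (sys.orderPlus ^ n) (sys.orderMinus ^ n) :=
    SemiconjBy.pow_right (rotation_mul_orderPlus hγ hv) n
  have hx : SemiconjBy (sys.rotation γ) X X := hX
  exact ((hm.mul_right hx).mul_right hn).eq

end U1System

end Literature.MathematicalPhysics.QuantumLattice.KomaTasaki
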